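import Summits.QuantumAdvantage.QuantumAdvantage.Theorems.NearExactIsExact.Negative.TightTypeTFourteen
import Summits.QuantumAdvantage.QuantumAdvantage.Theorems.NearExactIsExact.Negative.PfaffianPeriodFourteen
import Summits.QuantumAdvantage.QuantumAdvantage.Theorems.CubicForrelationNearExactIsExactFourteenSecondTypeOLowRank
import Summits.QuantumAdvantage.QuantumAdvantage.Theorems.CubicForrelationNearExactIsExactFourierPeriods

/-!
# No tight type-O pair: the value `61/64` needs a level-6 side (NearExactIsExact, disprover gen 24)

Negative/structural theorem for the crux `CubicForrelation.NearExactIsExact` (item r2), finite slice `n = 14`.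
HONEST FRAMING: a statement about cubic Boolean functions on 14 bits — NOT summit progress; no violation of `NearExactIsExact`.

`typeT_pair_false`: there is NO cubic pair `f, g` on 14 bits with both sides of type O (`W_g = 32u`, `W_f = 32v`, `u, v` odd)
and `Φ(f,g) ≥ 61/64`.  Proof (all elementary, see `…Negative.TightTypeTFourteen`, `…Negative.PfaffianPeriodFourteen`):
the side `g` is tight, `E = {d₁ = d₂}` has `2¹⁰` points and degree `≤ 4`, i.e. `1_E` is a minimum-weight word of `RM(4,14)`, so
every difference `t = a ⊕ b` of two points of `E` is a PERIOD of `1_E` (`tf_period_of_min_weight` — derivative of lower degree and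
too small weight); by `pp_period_pf` the Pfaffian form of the quadratic digit satisfies `Pf(t;·,·,·) = 0`.  If `B(t,·) ≠ 0` this
forces `B = ℓ_t ∧ ℓ_a`, whose radical has `≥ 2¹²` points (`tf_rank_two_card`) — excluded by the tree's `fo_lowrank_false`; if
`B(t,·) = 0` then `F(x ⊕ t) = ±F(x)` for the residual `F = u − 4(−1)^f`, whose transform `F̂ = −128(v − 4(−1)^g)` never
vanishes (`tt_dual`, `v` odd), forcing `t = 0` (`tf_radical_period_zero`) — but `t ≠ 0`.
Consequence (`…Negative.SixtyOneNotAttainedFourteen`): with `levelSix_false_61c`, `61/64 ≤ Φ ⇒ Φ = 1` for cubic pairs on 14 bits.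
Sources: [this work]; F. J. MacWilliams, N. J. A. Sloane (1977) Ch. 13 §4 (minimum-weight words of RM codes), Ch. 15.
Standard axioms only. -/

set_option linter.dupNamespace false -- D-0017: single-problem summit ⇒ `QuantumAdvantage.QuantumAdvantage` by design

noncomputable section

namespace Summit.QuantumAdvantage.QuantumAdvantage.Theorems.NearExactIsExact.Negative.TypeTFalseFourteen

open Finset
open Literature.Computability.QuantumComplexity
open Literature.Computability.QuantumComplexity.BuzetChailloux (bxor zeroVec bxor_bxor_cancel_left bxor_zeroVec zeroVec_bxor
  bxor_comm bxor_self)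
open Literature.Computability.QuantumComplexity.DerivativeWalsh (W twist_bxor_left)
open Summit.QuantumAdvantage.QuantumAdvantage.Theorems.CubicForrelation.NearExactIsExact
open Summit.QuantumAdvantage.QuantumAdvantage.Theorems.NearExactIsExact.Negative.TightTypeTFourteen
  (tt_tight tt_decode tt_mod_eight tt_dual)
open Summit.QuantumAdvantage.QuantumAdvantage.Theorems.NearExactIsExact.Negative.PfaffianPeriodFourteen (pp_period_pf)

variable {n : ℕ}

/-! ### Minimum-weight words of `RM(r+1, n)`: every difference of two support points is a period -/

/-- **Periods of a minimum-weight word.**  If `P` has degree `≤ r+1` and exactly `2^{n−r−1}` ones, then for any two ones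
`a, b` of `P` the vector `a ⊕ b` is a period of `P`.  (The derivative `P ⊕ P(· ⊕ t)` has degree `≤ r`; if non-zero its weight
is `≥ 2^{n−r}`, but it vanishes at `a, b` and is supported on `supp P ∪ (supp P ⊕ t)`, of size `≤ 2^{n−r} − 2`.)
Minimum-weight words of RM codes are flats [MacWilliams–Sloane Ch. 13]; this is the part we need.  NOT summit progress.
[this work] -/
theorem tf_period_of_min_weight {r : ℕ} (P : (Fin n → Bool) → Bool) (hP : IsDegLeFun (r + 1) P)
    (hcard : 2 ^ (r + 1) * #(univ.filter fun x => P x = true) = 2 ^ n)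
    (a b : Fin n → Bool) (ha : P a = true) (hb : P b = true) (x : Fin n → Bool) :
    P (bxor x (bxor a b)) = P x := by
  classical
  by_cases hab : a = b
  · subst hab; rw [bxor_self, bxor_zeroVec]
  by_contra hx
  have hD : IsDegLeFun r (fun y => P y ^^ P (bxor y (bxor a b))) := stub_derivDegree n r P (bxor a b) hP
  have hne : ∃ y, (P y ^^ P (bxor y (bxor a b))) = true :=
    ⟨x, by cases h1 : P x <;> cases h2 : P (bxor x (bxor a b)) <;> simp_all⟩
  have hw := bb_rmWeight_holds n r _ hD hne
  set S := univ.filter fun y : Fin n → Bool => P y = true with hS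
  have hsub : (univ.filter fun y : Fin n → Bool => (P y ^^ P (bxor y (bxor a b))) = true) ⊆
      (S ∪ S.image fun y => bxor y (bxor a b)) \ {a, b} := by
    intro y hy
    rw [mem_filter] at hy
    rw [mem_sdiff, mem_union, mem_insert, mem_singleton]
    constructor
    · cases h1 : P y
      · right
        rw [mem_image]
        refine ⟨bxor y (bxor a b), mem_filter.2 ⟨mem_univ _, ?_⟩, ?_⟩
        · have h2 := hy.2
          rw [h1] at h2
          simpa using h2
        · rw [bxor_comm y (bxor a b), bxor_comm (bxor (bxor a b) y) (bxor a b), bxor_bxor_cancel_left]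
      · left; exact mem_filter.2 ⟨mem_univ _, h1⟩
    · rintro (rfl | rfl)
      · have e : bxor y (bxor y b) = b := bxor_bxor_cancel_left y b
        rw [e, ha, hb] at hy
        simp at hy
      · have e : bxor y (bxor a y) = a := by rw [bxor_comm a y, bxor_bxor_cancel_left]
        rw [e, ha, hb] at hy
        simp at hy
  have hab' : ({a, b} : Finset (Fin n → Bool)) ⊆ S ∪ S.image (fun y => bxor y (bxor a b)) := by
    intro y hy
    rw [mem_insert, mem_singleton] at hy
    rcases hy with rfl | rfl
    · exact mem_union_left _ (mem_filter.2 ⟨mem_univ _, ha⟩)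
    · exact mem_union_left _ (mem_filter.2 ⟨mem_univ _, hb⟩)
  have h2 : #({a, b} : Finset (Fin n → Bool)) = 2 := card_pair hab
  have hU : #(S ∪ S.image fun y => bxor y (bxor a b)) ≤ #S + #S :=
    (card_union_le _ _).trans (by have := card_image_le (s := S) (f := fun y => bxor y (bxor a b)); omega)
  have hDcard : #(univ.filter fun y : Fin n → Bool => (P y ^^ P (bxor y (bxor a b))) = true) + 2 ≤ 2 * #S := by
    have h := card_le_card hsub
    rw [card_sdiff_of_subset hab', h2] at h
    have h3 : 2 ≤ #(S ∪ S.image fun y => bxor y (bxor a b)) := by rw [← h2]; exact card_le_card hab'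
    omega
  have hmul := Nat.mul_le_mul_left (2 ^ r) hDcard
  rw [pow_succ] at hcard
  have hpos : 0 < 2 ^ r := Nat.two_pow_pos r
  nlinarith

/-! ### The alternating form: rank-2 structure and translation -/

/-- **Rank-2 structure has a large radical.**  For quadratic `q` with form `B(x,y) = q0 ⊕ qx ⊕ qy ⊕ q(x⊕y)`: if `B(a,t) = 1` and
the Pfaffian form `Pf(t;a,·,·)` vanishes identically, then `B = ℓ_t ∧ ℓ_a` and its radical has at least `2ⁿ/4` points
(`ker ℓ_t ∩ ker ℓ_a ⊆ rad B`; the four fibres of `(ℓ_t, ℓ_a)` are translates of the kernel).  NOT summit progress. [this work] -/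
theorem tf_rank_two_card (q : (Fin n → Bool) → Bool) (hq : IsDegLeFun 2 q) (t a : Fin n → Bool)
    (hta : (q zeroVec ^^ q a ^^ q t ^^ q (bxor a t)) = true)
    (hPf : ∀ b c : Fin n → Bool,
      ((((q zeroVec ^^ q a ^^ q t ^^ q (bxor a t)) && (q zeroVec ^^ q c ^^ q b ^^ q (bxor c b))) ^^
        ((q zeroVec ^^ q b ^^ q t ^^ q (bxor b t)) && (q zeroVec ^^ q c ^^ q a ^^ q (bxor c a)))) ^^
        ((q zeroVec ^^ q c ^^ q t ^^ q (bxor c t)) && (q zeroVec ^^ q b ^^ q a ^^ q (bxor b a)))) = false) :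
    2 ^ n ≤ 4 * #(univ.filter fun x : Fin n → Bool => ∀ y, (q zeroVec ^^ q x ^^ q y ^^ q (bxor x y)) = false) := by
  classical
  set K := univ.filter fun x : Fin n → Bool =>
    (q zeroVec ^^ q x ^^ q t ^^ q (bxor x t)) = false ∧ (q zeroVec ^^ q x ^^ q a ^^ q (bxor x a)) = false with hK
  -- `K ⊆ rad B`
  have hKrad : K ⊆ univ.filter fun x : Fin n → Bool => ∀ y, (q zeroVec ^^ q x ^^ q y ^^ q (bxor x y)) = false := by
    intro x hx
    rw [hK, mem_filter] at hx
    refine mem_filter.2 ⟨mem_univ _, fun y => ?_⟩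
    have h := hPf x y
    rw [hta, hx.2.1, hx.2.2, es_B_symm q y x] at h
    revert h
    cases (q zeroVec ^^ q x ^^ q y ^^ q (bxor x y)) <;> cases (q zeroVec ^^ q y ^^ q t ^^ q (bxor y t)) <;>
      cases (q zeroVec ^^ q y ^^ q a ^^ q (bxor y a)) <;> simp
  -- every fibre of `x ↦ (B(x,t), B(x,a))` has at most `#K` points
  have hfib : ∀ v : Bool × Bool, #(univ.filter fun x : Fin n → Bool =>
      ((q zeroVec ^^ q x ^^ q t ^^ q (bxor x t)), (q zeroVec ^^ q x ^^ q a ^^ q (bxor x a))) = v) ≤ #K := by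
    intro v
    by_cases hv : ∃ x₁, ((q zeroVec ^^ q x₁ ^^ q t ^^ q (bxor x₁ t)), (q zeroVec ^^ q x₁ ^^ q a ^^ q (bxor x₁ a))) = v
    · obtain ⟨x₁, hx₁⟩ := hv
      refine card_le_card_of_injOn (fun x => bxor x x₁) (fun x hx => ?_) (fun x _ y _ hxy => ?_)
      · rw [mem_coe, mem_filter] at hx
        rw [mem_coe, hK, mem_filter]
        refine ⟨mem_univ _, ?_, ?_⟩
        · rw [es_B_add_left q hq x x₁ t]
          have h1 := congrArg Prod.fst hx.2
          have h2 := congrArg Prod.fst hx₁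
          simp only at h1 h2
          rw [h1, h2, Bool.xor_self]
        · rw [es_B_add_left q hq x x₁ a]
          have h1 := congrArg Prod.snd hx.2
          have h2 := congrArg Prod.snd hx₁
          simp only at h1 h2
          rw [h1, h2, Bool.xor_self]
      · have h := congrArg (fun z => bxor z x₁) hxy
        simpa [Summit.QuantumAdvantage.QuantumAdvantage.Theorems.CubicForrelation.NearExactIsExact.iw_bxor_assoc] using h
    · have h0 : (univ.filter fun x : Fin n → Bool =>
          ((q zeroVec ^^ q x ^^ q t ^^ q (bxor x t)), (q zeroVec ^^ q x ^^ q a ^^ q (bxor x a))) = v) = ∅ :=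
        filter_eq_empty_iff.2 fun x _ hx => hv ⟨x, hx⟩
      rw [h0, card_empty]
      exact Nat.zero_le _
  have hsum := card_eq_sum_card_fiberwise (s := (univ : Finset (Fin n → Bool))) (t := (univ : Finset (Bool × Bool)))
    (f := fun x => ((q zeroVec ^^ q x ^^ q t ^^ q (bxor x t)), (q zeroVec ^^ q x ^^ q a ^^ q (bxor x a))))
    fun x _ => mem_univ _
  have hle : ∑ v ∈ (univ : Finset (Bool × Bool)), #(univ.filter fun x : Fin n → Bool =>
      ((q zeroVec ^^ q x ^^ q t ^^ q (bxor x t)), (q zeroVec ^^ q x ^^ q a ^^ q (bxor x a))) = v) ≤ 4 * #K := by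
    refine (sum_le_sum fun v _ => hfib v).trans ?_
    rw [sum_const, card_univ, Fintype.card_prod, Fintype.card_bool, smul_eq_mul]
  rw [card_univ, Fintype.card_fun, Fintype.card_bool, Fintype.card_fin] at hsum
  calc 2 ^ n = _ := hsum
    _ ≤ 4 * #K := hle
    _ ≤ 4 * #(univ.filter fun x : Fin n → Bool => ∀ y, (q zeroVec ^^ q x ^^ q y ^^ q (bxor x y)) = false) :=
        Nat.mul_le_mul_left 4 (card_le_card hKrad)

/-- **A sign-twisted period with nowhere-vanishing transform is trivial.**  If `F(x ⊕ t) = c·F(x)` for all `x` and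
`F̂(y) ≠ 0` for all `y`, then `t = 0`.  (`F̂(y) = c(−1)^{t·y}F̂(y)` by translation, so `(−1)^{t·y}` is constant.)
NOT summit progress. [this work] -/
theorem tf_radical_period_zero (F : (Fin n → Bool) → ℝ) (t : Fin n → Bool) (c : ℝ) (hper : ∀ x, F (bxor x t) = c * F x)
    (hW : ∀ y, W F y ≠ 0) : t = zeroVec := by
  have key : ∀ y, c * twist t y = 1 := by
    intro y
    have h := fp_W_translate F t y
    have e : ∑ x, F (bxor x t) * twist (bxor x t) y = c * twist t y * W F y := by
      unfold W
      rw [mul_sum]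
      exact sum_congr rfl fun x _ => by rw [hper x, twist_bxor_left]; ring
    rw [e] at h
    have h' : (c * twist t y - 1) * W F y = 0 := by linarith
    have := (mul_eq_zero.1 h').resolve_right (hW y)
    linarith
  have hc : ∀ y, twist t y = c := by
    intro y
    have h1 := key y
    have h2 := Simon.twist_mul_self t y
    have : c = c * (twist t y * twist t y) := by rw [h2, mul_one]
    rw [this]
    linear_combination (-(twist t y)) * h1
  have hsum := Simon.sum_twist t
  rw [sum_congr rfl fun y _ => hc y, sum_const, card_univ, Fintype.card_fun, Fintype.card_bool, Fintype.card_fin,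
    nsmul_eq_mul] at hsum
  by_contra ht
  have ht' : ¬ t = (fun _ => false) := ht
  rw [if_neg ht'] at hsum
  have hc0 : c ≠ 0 := by intro h; have := key zeroVec; rw [h, zero_mul] at this; exact zero_ne_one this
  have : (2 : ℝ) ^ n * c ≠ 0 := mul_ne_zero (by positivity) hc0
  exact this (by exact_mod_cast hsum)

/-! ### Assembly -/

set_option maxHeartbeats 1600000 in
/-- **THEOREM (no type-T pair).**  There are no cubic `f, g` on 14 bits with `W_g = 32u`, `W_f = 32v`, all `u(x)` and `v(y)` odd,
and `Φ(f,g) ≥ 61/64`.  Finite-slice statement at `n = 14`; NOT summit progress. [this work] -/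
theorem typeT_pair_false (f g : (Fin (7 + 7) → Bool) → Bool) (hf : IsDegLeFun 3 f) (hg : IsDegLeFun 3 g)
    (u : (Fin (7 + 7) → Bool) → ℤ) (hu : ∀ x, W (fun y => signOf (g y)) x = (2 : ℝ) ^ 5 * (u x : ℝ))
    (hoddu : ∀ x, Odd (u x))
    (v : (Fin (7 + 7) → Bool) → ℤ) (hv : ∀ y, W (fun x => signOf (f x)) y = (2 : ℝ) ^ 5 * (v y : ℝ))
    (hoddv : ∀ y, Odd (v y)) (hΦ : (61 / 64 : ℝ) ≤ forrelation f g) : False := by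
  classical
  obtain ⟨hEcard, hpt, -⟩ := tt_tight f g hf hg u hu hoddu hΦ
  have hq : IsDegLeFun 2 (fun x => decide (Odd (u x / 2))) := fd_digitOne g u hg hu
  have hd2 : IsDegLeFun 4 (fun x => decide (Odd (u x / 2 / 2))) := fd_digitTwo g u hg hu
  have he4 : IsDegLeFun (3 + 1) (fun x => decide (Odd (u x / 2) ↔ Odd (u x / 2 / 2))) := by
    have h := tb_isDegLeFun_xor_const (bb_isDegLeFun_bxor (hq.mono (by norm_num)) hd2) true
    have hfun : (fun x => (decide (Odd (u x / 2)) ^^ decide (Odd (u x / 2 / 2))) ^^ true) =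
        (fun x => decide (Odd (u x / 2) ↔ Odd (u x / 2 / 2))) := by
      funext x
      by_cases h1 : Odd (u x / 2) <;> by_cases h2 : Odd (u x / 2 / 2) <;> simp [h1, h2]
    rw [hfun] at h
    exact h
  have hsupp : (univ.filter fun x : Fin (7 + 7) → Bool => decide (Odd (u x / 2) ↔ Odd (u x / 2 / 2)) = true) =
      univ.filter fun x => (Odd (u x / 2) ↔ Odd (u x / 2 / 2)) :=
    filter_congr fun x _ => by rw [decide_eq_true_iff]
  have hcardE : 2 ^ (3 + 1) * #(univ.filter fun x : Fin (7 + 7) → Bool =>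
      decide (Odd (u x / 2) ↔ Odd (u x / 2 / 2)) = true) = 2 ^ (7 + 7) := by
    rw [hsupp, hEcard]; norm_num
  -- two distinct points of `E`, and the non-zero period `t = a ⊕ b`
  obtain ⟨a, ha, b, hb, hab⟩ := one_lt_card.1 (show 1 < #(univ.filter fun x : Fin (7 + 7) → Bool =>
    (Odd (u x / 2) ↔ Odd (u x / 2 / 2))) by rw [hEcard]; norm_num)
  have ha' : decide (Odd (u a / 2) ↔ Odd (u a / 2 / 2)) = true := decide_eq_true (mem_filter.1 ha).2
  have hb' : decide (Odd (u b / 2) ↔ Odd (u b / 2 / 2)) = true := decide_eq_true (mem_filter.1 hb).2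
  have ht0 : bxor a b ≠ zeroVec := by
    intro h
    apply hab
    have h2 := congrArg (fun z => bxor z b) h
    simpa [Summit.QuantumAdvantage.QuantumAdvantage.Theorems.CubicForrelation.NearExactIsExact.iw_bxor_assoc] using h2
  have hper : ∀ x, decide (Odd (u (bxor x (bxor a b)) / 2) ↔ Odd (u (bxor x (bxor a b)) / 2 / 2)) =
      decide (Odd (u x / 2) ↔ Odd (u x / 2 / 2)) :=
    tf_period_of_min_weight (fun x => decide (Odd (u x / 2) ↔ Odd (u x / 2 / 2))) he4 hcardE a b ha' hb'
  have hmod := tt_mod_eight f u hoddu hpt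
  have hEne : ∃ x, (Odd (u x / 2) ↔ Odd (u x / 2 / 2)) := ⟨a, (mem_filter.1 ha).2⟩
  by_cases hrad : ∀ y, (decide (Odd (u zeroVec / 2)) ^^ decide (Odd (u (bxor a b) / 2)) ^^ decide (Odd (u y / 2)) ^^
      decide (Odd (u (bxor (bxor a b) y) / 2))) = false
  · -- radical case: `F(x ⊕ t) = ± F(x)` and `F̂ ≠ 0` force `t = 0`
    have hF := tt_decode f u hoddu hpt
    have hqt : ∀ x, decide (Odd (u (bxor x (bxor a b)) / 2)) =
        (decide (Odd (u x / 2)) ^^ (decide (Odd (u zeroVec / 2)) ^^ decide (Odd (u (bxor a b) / 2)))) := by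
      intro x
      have h := es_second_deriv (fun z => decide (Odd (u z / 2))) hq zeroVec (bxor a b) x
      simp only [zeroVec_bxor] at h
      rw [hrad x, bxor_comm (bxor a b) x] at h
      rw [h]
      cases decide (Odd (u zeroVec / 2)) <;> cases decide (Odd (u (bxor a b) / 2)) <;> cases decide (Odd (u x / 2)) <;> rfl
    have hZ : ∀ x, u (bxor x (bxor a b)) - 4 * sZ (f (bxor x (bxor a b))) =
        (if (decide (Odd (u zeroVec / 2)) ^^ decide (Odd (u (bxor a b) / 2))) = true then -1 else 1 : ℤ) *
          (u x - 4 * sZ (f x)) := by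
      intro x
      have hex : (Odd (u (bxor x (bxor a b)) / 2) ↔ Odd (u (bxor x (bxor a b)) / 2 / 2)) ↔
          (Odd (u x / 2) ↔ Odd (u x / 2 / 2)) := decide_eq_decide.1 (hper x)
      have ho : Odd (u (bxor x (bxor a b)) / 2) ↔
          (decide (Odd (u x / 2)) ^^ (decide (Odd (u zeroVec / 2)) ^^ decide (Odd (u (bxor a b) / 2)))) = true := by
        rw [← hqt x, decide_eq_true_iff]
      have ho' : (if Odd (u (bxor x (bxor a b)) / 2) then 1 else 0 : ℤ) =
          if (decide (Odd (u x / 2)) ^^ (decide (Odd (u zeroVec / 2)) ^^ decide (Odd (u (bxor a b) / 2)))) = true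
            then 1 else 0 := by
        simp only [ho]
      have hex' : (if (Odd (u (bxor x (bxor a b)) / 2) ↔ Odd (u (bxor x (bxor a b)) / 2 / 2)) then 1 else 0 : ℤ) =
          if (Odd (u x / 2) ↔ Odd (u x / 2 / 2)) then 1 else 0 := by
        simp only [hex]
      rw [hF (bxor x (bxor a b)), hF x, ho', hex']
      by_cases h3 : (Odd (u x / 2) ↔ Odd (u x / 2 / 2))
      · rw [if_pos h3]
        by_cases h1 : Odd (u x / 2) <;>
          cases (decide (Odd (u zeroVec / 2)) ^^ decide (Odd (u (bxor a b) / 2))) <;> simp [h1]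
      · rw [if_neg h3]
        by_cases h1 : Odd (u x / 2) <;>
          cases (decide (Odd (u zeroVec / 2)) ^^ decide (Odd (u (bxor a b) / 2))) <;> simp [h1]
    have hperF : ∀ x, (fun z => ((u z - 4 * sZ (f z) : ℤ) : ℝ)) (bxor x (bxor a b)) =
        (((if (decide (Odd (u zeroVec / 2)) ^^ decide (Odd (u (bxor a b) / 2))) = true then -1 else 1 : ℤ) : ℤ) : ℝ) *
          (fun z => ((u z - 4 * sZ (f z) : ℤ) : ℝ)) x := by
      intro x
      simp only []
      rw [hZ x, Int.cast_mul]
    have hW : ∀ y, W (fun z => ((u z - 4 * sZ (f z) : ℤ) : ℝ)) y ≠ 0 := by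
      intro y
      rw [tt_dual f g u hu v hv y]
      have hne : v y - 4 * sZ (g y) ≠ 0 := by
        obtain ⟨k, hk⟩ := hoddv y
        rcases tp_sZ_cases (g y) with hs | hs <;> omega
      exact mul_ne_zero (by norm_num) (by exact_mod_cast hne)
    exact ht0 (tf_radical_period_zero _ (bxor a b) _ hperF hW)
  · -- rank-2 case
    push Not at hrad
    obtain ⟨a', ha'ne⟩ := hrad
    have hBat : (decide (Odd (u zeroVec / 2)) ^^ decide (Odd (u a' / 2)) ^^ decide (Odd (u (bxor a b) / 2)) ^^
        decide (Odd (u (bxor a' (bxor a b)) / 2))) = true := by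
      rw [es_B_symm (fun z => decide (Odd (u z / 2))) a' (bxor a b)]
      revert ha'ne
      cases (decide (Odd (u zeroVec / 2)) ^^ decide (Odd (u (bxor a b) / 2)) ^^ decide (Odd (u a' / 2)) ^^
        decide (Odd (u (bxor (bxor a b) a') / 2))) <;> simp
    have hPf := fun b' c' => pp_period_pf g hg u hu (fun z => decide (Odd (u z / 2)))
      (fun z => decide (Odd (u z / 2) ↔ Odd (u z / 2 / 2))) hq hmod (bxor a b) hper a' b' c'
    have hK := tf_rank_two_card (fun z => decide (Odd (u z / 2))) hq (bxor a b) a' hBat hPf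
    have hrad12 : 2 ^ 12 ≤ #(univ.filter fun x : Fin (7 + 7) → Bool => ∀ y, (decide (Odd (u zeroVec / 2)) ^^
        decide (Odd (u x / 2)) ^^ decide (Odd (u y / 2)) ^^ decide (Odd (u (bxor x y) / 2))) = false) := by
      norm_num at hK ⊢
      omega
    exact fo_lowrank_false f g hg u hu hoddu hrad12 hEne (by linarith)

end Summit.QuantumAdvantage.QuantumAdvantage.Theorems.NearExactIsExact.Negative.TypeTFalseFourteen

end
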